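import Summits.MatrixMultiplication.MatrixMultiplication.Theses.AssociativePencil

/-!
# TameNodeCurves (stmt-MatrixMultiplication-7189) — typed candidate pieces for the decomposition census

Crux-strategist RESTATED re-audit, 2026-08-17. Every candidate piece `Xᵢ` of a decomposition
`X₁ ∧ … ∧ X_k → TameNodeCurves` that the census (`STRATEGY-CENSUS.md`) discusses AS A SIGNATURE is typed
here over the tree's vocabulary (`matMulTensor`, `tensorRank`), in the exact shape of the route's clauses.
Nothing here is filed as an item: each candidate is rejected in the census (reason quoted per decl).
Definitions only; the file elaborates sorry-free.
-/

set_option linter.dupNamespace false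

namespace Summit.MatrixMultiplication.MatrixMultiplication.Cruxes.TameNodeCurves.Census

open scoped BigOperators
open Literature.Computability.AlgebraicComplexity

/-- Coordinate tensors on `ℂ^{n×n}` (structure constants `β z x y` = coefficient of `E_z` in `x·y`). -/
abbrev T (n : ℕ) : Type := Fin n × Fin n → Fin n × Fin n → Fin n × Fin n → ℂ

/-- The node value `F(node i)` of the family `F(t) = ∑ⱼ tʲ νⱼ`. -/
def nodeValue {n s : ℕ} (ν : Fin (s + 1) → T n) (node : Fin (s + 1) → ℂ) (i : Fin (s + 1)) : T n :=
  fun z x y => ∑ j : Fin (s + 1), node i ^ (j : ℕ) * ν j z x y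

/-- The route's associativity clause for the whole family (every fibre `F(t)` associative). -/
def FamilyAssoc {n s : ℕ} (ν : Fin (s + 1) → T n) : Prop :=
  ∀ t : ℂ, ∀ x y z w : Fin n × Fin n,
    ∑ u, (∑ j : Fin (s + 1), t ^ (j : ℕ) * ν j u x y) * (∑ j : Fin (s + 1), t ^ (j : ℕ) * ν j w u z) =
      ∑ v, (∑ j : Fin (s + 1), t ^ (j : ℕ) * ν j v y z) * (∑ j : Fin (s + 1), t ^ (j : ℕ) * ν j w x v)

/-- TNC with the tameness clause abstracted into a node predicate `P n C (F(node i))`: the common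
shape of every "node-class" decomposition `NodeCurvesWith P ∧ (P-nodes are tame) → TameNodeCurves`. -/
def NodeCurvesWith (P : (n : ℕ) → ℝ → T n → Prop) : Prop :=
  ∀ ε : ℝ, 0 < ε → ∃ C : ℝ, 0 < C ∧ ∀ n₀ : ℕ, ∃ n : ℕ, n₀ ≤ n ∧ 2 ≤ n ∧ ∃ s : ℕ,
    (s : ℝ) + 1 ≤ (n : ℝ) ^ ε ∧ ∃ ν : Fin (s + 1) → T n, ν (Fin.last s) = matMulTensor ℂ n n n ∧
      FamilyAssoc ν ∧ ∃ node : Fin (s + 1) → ℂ, Function.Injective node ∧ ∀ i, P n C (nodeValue ν node i)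

/-- **Every node-class split has a trivial seam.** For ANY node predicate `P`, the decomposition
`NodeCurvesWith P ∧ (P-nodes have rank ≤ C n²) → TameNodeCurves` is proved by pure quantifier threading
(this 5-line proof) — the BC2 (b) sense of "cut along a trivial seam". A node-class split can only be
made to LOOK non-trivial by stating tameness for abstract algebras and nodes up to isomorphism, which
relocates a generic transport lemma into the assembly without changing the mathematics (census §D0). -/
theorem nodeClassSplit_trivialSeam (P : (n : ℕ) → ℝ → T n → Prop)
    (h1 : NodeCurvesWith P) (h2 : ∀ (n : ℕ) (C : ℝ) (β : T n), P n C β → (tensorRank β : ℝ) ≤ C * (n : ℝ) ^ 2) :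
    Summit.MatrixMultiplication.MatrixMultiplication.Theses.AssociativePencil.TameNodeCurves := by
  intro ε hε
  obtain ⟨C, hC, h⟩ := h1 ε hε
  refine ⟨C, hC, fun n₀ => ?_⟩
  obtain ⟨n, hn₀, hn2, s, hs, ν, hνs, hassoc, node, hnode, hP⟩ := h n₀
  exact ⟨n, hn₀, hn2, s, hs, ν, hνs, hassoc, node, hnode, fun i => h2 n C _ (hP i)⟩

/-- Sanity: with `P = (rank ≤ C n²)` this is literally the crux. -/
example : NodeCurvesWith (fun n C β => (tensorRank β : ℝ) ≤ C * (n : ℝ) ^ 2) ↔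
    Summit.MatrixMultiplication.MatrixMultiplication.Theses.AssociativePencil.TameNodeCurves := Iff.rfl

/-! ## Attempt 0 (sandwich, not a decomposition): `RankLinear` -/

/-- `RankLinear`: exact rank `O(n²)` infinitely often. `RankLinear → TameNodeCurves` is PROVED
(`CensusEvidence.lean: tameNodeCurves_of_rankLinear`, degree-0 family), and `TameNodeCurves → ω = 2` is the
route's `closes`; so TNC is sandwiched between two open statements and `¬TNC` is a super-linear rank
lower bound (LinearRankMethodBarrier). -/
def RankLinear : Prop :=
  ∃ C : ℝ, 0 < C ∧ ∀ n₀ : ℕ, ∃ n : ℕ, n₀ ≤ n ∧ 2 ≤ n ∧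
    (tensorRank (matMulTensor ℂ n n n) : ℝ) ≤ C * (n : ℝ) ^ 2

/-! ## Attempt 1 (best typed split): sparse nodes -/

/-- `β` is, after ONE change of basis `f = G·e` of `ℂ^{n×n}` (with inverse `H`), supported on at most
`C·n²` structure constants: `β'(a;b,c) = ∑ H z a · G b x · G c y · β z x y` has `≤ C n²` non-zero entries.
Non-linear in `β` (the basis depends on the node), as Lagrange linearity demands. -/
def SparseInSomeBasis (n : ℕ) (C : ℝ) (β : T n) : Prop :=
  ∃ G H : (Fin n × Fin n) → (Fin n × Fin n) → ℂ,
    (∀ a b, ∑ k, G a k * H k b = if a = b then 1 else 0) ∧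
    (∀ a b, ∑ k, H a k * G k b = if a = b then 1 else 0) ∧
    ((Finset.univ.filter fun p : (Fin n × Fin n) × (Fin n × Fin n) × (Fin n × Fin n) =>
        (∑ z, ∑ x, ∑ y, H z p.1 * G p.2.1 x * G p.2.2 y * β z x y) ≠ 0).card : ℝ) ≤ C * (n : ℝ) ^ 2

/-- X₁ of attempt 1: few-node associative curves through `Mat_n` whose node algebras admit sparse
multiplication tables (covers the tame boundary points we know: `D ⋉ M`, geodesic algebras of
quasi-metrics with few geodesic triples, radical-square-zero algebras with bounded blocks).
REJECTED as a piece: with X₂ = `SparseAlgebrasTame` (a provable LEMMA, hollow) the split is one open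
crux again, and X₁ minus associativity gives `R(⟨n,n,n⟩) ≤ C·n^{2+ε}` by support counting — i.e. X₁ is
elementarily at-least-summit, RESTATED one level down (census §Decomposition, row 1). -/
def SparseNodeCurves : Prop := NodeCurvesWith SparseInSomeBasis

/-- X₂ of attempt 1: sparse-in-some-basis ⟹ rank `≤ C n²` (transport is a restriction both ways,
`TensorRestrictsTo.tensorRank_le`; a tensor with `k` non-zero entries has rank `≤ k`,
`tensorRank_le_card_of_eq_sum`). Provable now — which is exactly why it is not a crux. -/
def SparseAlgebrasTame : Prop :=
  ∀ (n : ℕ) (C : ℝ) (β : T n), SparseInSomeBasis n C β → (tensorRank β : ℝ) ≤ C * (n : ℝ) ^ 2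

/-- The assembly of attempt 1 is genuine but routine (quantifier threading); stated, not filed. -/
def Attempt1Assembly : Prop :=
  SparseNodeCurves → SparseAlgebrasTame →
    Summit.MatrixMultiplication.MatrixMultiplication.Theses.AssociativePencil.TameNodeCurves

/-- Proof of the attempt-1 assembly: an instance of the trivial seam. -/
theorem attempt1Assembly_proof : Attempt1Assembly :=
  fun h1 h2 => nodeClassSplit_trivialSeam SparseInSomeBasis h1 h2

/-! ## Attempt 2: box / truncated-Weyl nodes -/

/-- Structure tensor of the twisted truncated polynomial algebra
`A_q(a,b) = ℂ⟨X,Z⟩/(ZX = qXZ, X^a, Z^b)` in the PBW basis `X^i Z^j`: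
`(X^i Z^j)(X^k Z^l) = q^{jk} X^{i+k} Z^{j+l}` (zero if `i+k ≥ a` or `j+l ≥ b`). For `q = 1` this is
`ℂ[x,z]/(x^a,z^b)` (rank `≤ (2a-1)(2b-1)` by bivariate interpolation); for `a = b = n` and `q` a primitive
`n`-th root of unity it is the maximally degenerate fibre of the clock–shift (cyclic algebra)
presentation of `Mat_n`. -/
def boxTensor (q : ℂ) (a b : ℕ) : (Fin a × Fin b) → (Fin a × Fin b) → (Fin a × Fin b) → ℂ :=
  fun p x y => if (x.1 : ℕ) + y.1 = p.1 ∧ (x.2 : ℕ) + y.2 = p.2 then q ^ ((x.2 : ℕ) * y.1) else 0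

/-- X₂ of attempt 2: box algebras are tame uniformly in `q`. REJECTED: summit-or-harder — for `q` of
multiplicative order `> n/4` (in particular the Weyl fibre, `q` primitive of order `n`, and every
non-root-of-unity), `A_q(n,n)` RESTRICTS TO `⟨n/4,n/4,n/4⟩` (census §F3: windowed evaluation at the points
`q^c ρ`; verified numerically for `n ≤ 32`), so this piece implies `R(⟨m,m,m⟩) ≤ 16C·m²`, i.e.
`RankLinear`, hence TNC and the summit by themselves. Restricted to `q` of bounded order it is a
classical theorem (interpolation) and the split degenerates to the shape of attempt 1. -/
def BoxAlgebrasTame : Prop :=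
  ∃ C : ℝ, 0 < C ∧ ∀ (q : ℂ) (a b : ℕ), (tensorRank (boxTensor q a b) : ℝ) ≤ C * ((a * b : ℕ) : ℝ)

/-- Node predicate of attempt 2: the node algebra is isomorphic (one change of basis `G`, inverse `H`,
between `ℂ^{n×n}` and `ℂ^{a×b}`, `ab = n²`) to some box algebra `A_q(a,b)`. -/
def IsBoxNode (n : ℕ) (_C : ℝ) (β : T n) : Prop :=
  ∃ (a b : ℕ) (q : ℂ) (G : (Fin a × Fin b) → (Fin n × Fin n) → ℂ) (H : (Fin n × Fin n) → (Fin a × Fin b) → ℂ),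
    a * b = n * n ∧ (∀ u v, ∑ k, G u k * H k v = if u = v then 1 else 0) ∧
    (∀ u v, ∑ k, H u k * G k v = if u = v then 1 else 0) ∧
    ∀ p x y, boxTensor q a b p x y = ∑ z, ∑ x', ∑ y', H z p * G x x' * G y y' * β z x' y'

/-- X₁ of attempt 2 (box-noded curves). Not filed: its partner `BoxAlgebrasTame` is summit-hard (above),
and with bounded-order `q` the partner is a known theorem, leaving one open at-least-summit crux. -/
def BoxNodeCurves : Prop := NodeCurvesWith IsBoxNode

/-! ## Attempt 12: commutative nodes (dead by Lagrange linearity) -/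

/-- X₁ of attempt 12: all node values commutative. REFUTED outright for every `s`:
`CensusEvidence.lean: no_commutative_nodes` (the top coefficient `⟨n,n,n⟩` would be commutative). The same
one-line argument kills every node class cut out by `ℂ`-LINEAR conditions on the product. -/
def CommutativeNodeCurves : Prop := NodeCurvesWith fun _n _C β => ∀ z x y, β z x y = β z y x

/-! ## Attempt 11/13: restriction-type node classes (dead by flattening count or τ-theorem) -/

/-- Node predicate of attempt 13 (CU-shaped split "thin-sandwich nodes + Coppersmith"): the node tensor is
a restriction of the thin rectangular product `⟨n, m, n⟩`, `m ≤ n^δ`. REFUTED by the flattening count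
(census §F5): `≤ n^ε` such nodes have total `X`-flattening rank `≤ n^{1+δ+ε} < n²`, but they must
Lagrange-span the concise `⟨n,n,n⟩`. -/
def IsThinSandwichNode (δ : ℝ) (n : ℕ) (_C : ℝ) (β : T n) : Prop :=
  ∃ m : ℕ, (m : ℝ) ≤ (n : ℝ) ^ δ ∧ TensorRestrictsTo (matMulTensor ℂ n m n) β

/-- X₁ of attempt 13. Dead (flattening count), recorded only. -/
def ThinSandwichNodeCurves (δ : ℝ) : Prop := NodeCurvesWith (IsThinSandwichNode δ)

end Summit.MatrixMultiplication.MatrixMultiplication.Cruxes.TameNodeCurves.Census
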